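import Summits.Ventures.PercRepro.Night2ThreeTwoUnsat

/-!
# PercRepro — the cell `(3, 2)`: the losses of the big pairs and the capacity of their missed-point targets
(night-2, gen 25)

In the `(7, 5)` cell `(3, 2)` (`|E ∖ G| = 3`, two coloops, `ρ = 4`) a middle target has at most two thin covering
preimages, each requesting `Φ/(m + 3) ≤ 7/30`, and its capacity is at least `5/12`.  Hence:

* `L1_le_req_add_of_three_two`: at a middle target, `L1 ≤ req B + 7/30` for each thin covering preimage `B`;
* **`loss_le_of_big_three_two`**: the loss of a big thin pair (`|B ∖ K| ≥ 4`) is at most `1/40` — the loss of a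
  fat face at a `(2, 2)`-saturated set; **`loss_le_of_big_three_two'`**: at most `1/198` when `B` misses `≥ 3` points;
* **`card_thin_coverPreimages_le_one_of_missed`**: a missed-point target `B ∪ {z, x}` of a big pair (`z ≠ x` both
  missed by `B`) has at most ONE thin covering preimage — two faces `T ∖ w`, `T ∖ w'` through `z` would span the same
  hyperplane (`K ∪ (B ∖ {w, w'}) ∪ {z}` already has rank `5`), so they coincide (`clF_injOn_coverPreimages`);
* **`cap2_ge_of_missed_three_two`**: such a target keeps `cap2 ≥ 5/12 − 7/30 = 11/60`.
These are the ingredients of the column bound `dload ≤ cap2` for the missed-point routing of the big pairs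
(`Night2LocalRuleMissed`), the obstruction-form cell's remaining step.
-/

namespace PercRepro.Shadow

open Finset PerFlat ThmH

variable {α : Type*} [DecidableEq α] {M : Matroid α} [M.Finite]

section ThreeTwoLoss

variable {G : Finset α}

/-- In the cell `(3, 2)` a thin member requests at most `7/30`. -/
theorem req_le_of_thin_three_two (hG : G ∈ flatsQ M (5 + 1)) (hd : (gr M \ G).card = 3) {B : Finset α}
    (hB : B ∈ thinMembers M 5 G) : req M 5 B ≤ 7 / 30 := by
  have hd' : (gr M \ G).card ≤ 5 := by omega
  have hm2 : 2 ≤ (G \ clF M B).card :=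
    two_le_card_sdiff_of_not_lay0 hG hd' (mem_thinMembers.1 hB).1 (mem_thinMembers.1 hB).2
  rw [req_eq_of_thin hG hB, hd]
  have h2 : (2 : ℚ) ≤ ((G \ clF M B).card : ℚ) := by exact_mod_cast hm2
  unfold phiQ
  push_cast
  rw [div_le_iff₀ (by linarith)]
  linarith

/-- In the cell `(3, 2)` a thin member missing at least three points requests at most `7/36`. -/
theorem req_le_of_thin_three_two' (hG : G ∈ flatsQ M (5 + 1)) (hd : (gr M \ G).card = 3) {B : Finset α}
    (hB : B ∈ thinMembers M 5 G) (hm3 : 3 ≤ (G \ clF M B).card) : req M 5 B ≤ 7 / 36 := by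
  rw [req_eq_of_thin hG hB, hd]
  have h3 : (3 : ℚ) ≤ ((G \ clF M B).card : ℚ) := by exact_mod_cast hm3
  unfold phiQ
  push_cast
  rw [div_le_iff₀ (by linarith)]
  linarith

open scoped Classical in
/-- At a middle target of the cell `(3, 2)`, `L1 S ≤ req B + 7/30` for every thin covering preimage `B` of `S`. -/
theorem L1_le_req_add_of_three_two (hG : G ∈ flatsQ M (5 + 1)) (hd : (gr M \ G).card = 3) (hk : kColoops M G = 2)
    (hs : ∀ e ∈ gr M, ∀ f ∈ gr M, e ≠ f → rkN M {e, f} = 2) (hl : ∀ e ∈ gr M, M.Indep {e}) {S : Finset α}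
    (hS : S ∈ shadowAt M (5 + 2) 5 (Uq M (5 + 2) 5) G) (hcard : 4 + 1 ≤ (S \ coloops M G).card) {B : Finset α}
    (hB : B ∈ (coverPreimages M (Uq M (5 + 2) 5) G S).filter (fun B => B ∉ lay0 M 5 G)) :
    L1 M 5 G S ≤ req M 5 B + 7 / 30 := by
  have hk' : kColoops M G + 4 = 5 + 1 := by omega
  have hd' : (gr M \ G).card ≤ 5 := by omega
  set P := (coverPreimages M (Uq M (5 + 2) 5) G S).filter (fun B => B ∉ lay0 M 5 G) with hP
  have hL1 : L1 M 5 G S = ∑ B ∈ P, req M 5 B := rfl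
  have hPcard : P.card + 2 ≤ 4 := card_thin_coverPreimages_add_two_le hG hd' hk' hs hl hS hcard
  have hthin : ∀ B' ∈ P, B' ∈ thinMembers M 5 G := by
    intro B' hB'
    rw [hP, Finset.mem_filter, mem_coverPreimages] at hB'
    exact mem_thinMembers.2 ⟨hB'.1.1, hB'.2⟩
  rw [hL1, ← Finset.add_sum_erase P _ hB]
  have h1 : ∑ B' ∈ P.erase B, req M 5 B' ≤ ∑ _B' ∈ P.erase B, (7 / 30 : ℚ) :=
    Finset.sum_le_sum (fun B' hB' => req_le_of_thin_three_two hG hd (hthin B' (Finset.mem_of_mem_erase hB')))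
  rw [Finset.sum_const, nsmul_eq_mul, Finset.card_erase_of_mem hB] at h1
  have hc : ((P.card - 1 : ℕ) : ℚ) ≤ 1 := by exact_mod_cast (by omega : P.card - 1 ≤ 1)
  nlinarith

/-- In the cell `(3, 2)` the capacity of every shadow set is at least `5/12`. -/
theorem capS_ge_five_twelfths_three_two (hd : (gr M \ G).card = 3) (hk : kColoops M G = 2) {S : Finset α}
    (hSG : S ⊆ G) : (5 / 12 : ℚ) ≤ capS M 5 G S := by
  have h := capS_ge_one_sub_kColoops (q := 5) hd hSG
  rw [hk] at h
  unfold phiQ at h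
  norm_num at h
  exact h

open scoped Classical in
/-- A thin member `B` with `z ∈ G ∖ cl B` is a thin covering preimage of `B ∪ {z}`. -/
theorem mem_thin_coverPreimages_insert {q : ℕ} {B : Finset α} (hB : B ∈ thinMembers M q G) {z : α}
    (hz : z ∈ G \ clF M B) :
    B ∈ (coverPreimages M (Uq M (q + 2) q) G (insert z B)).filter (fun B => B ∉ lay0 M q G) :=
  Finset.mem_filter.2 ⟨mem_coverPreimages.2 ⟨(mem_thinMembers.1 hB).1, mem_coverSets.2 ⟨z, hz, rfl⟩⟩,
    (mem_thinMembers.1 hB).2⟩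

/-- The loss of a thin pair at a covering set of capacity `≥ 5/12` with `L1 ≤ req + 7/30`: the arithmetic. -/
theorem loss_arith_three_two {r L c : ℚ} (hr0 : 0 ≤ r) (hr : r ≤ 7 / 30) (hc : 5 / 12 ≤ c) (hL : L ≤ r + 7 / 30)
    (hcL : c < L) : r * (1 - c / L) ≤ 1 / 40 := by
  have hLpos : 0 < L := by linarith
  rw [show r * (1 - c / L) = r * (L - c) / L by field_simp]
  rw [div_le_iff₀ hLpos]
  rcases le_or_gt (40 * r) 1 with h | h
  · nlinarith
  · nlinarith [mul_nonneg (sub_nonneg.2 hr) (by linarith : (0 : ℚ) ≤ 40 * r + 1)]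

/-- The same arithmetic with `r ≤ 7/36`: the loss is at most `1/198`. -/
theorem loss_arith_three_two' {r L c : ℚ} (hr0 : 0 ≤ r) (hr : r ≤ 7 / 36) (hc : 5 / 12 ≤ c) (hL : L ≤ r + 7 / 30)
    (hcL : c < L) : r * (1 - c / L) ≤ 1 / 198 := by
  have hLpos : 0 < L := by linarith
  rw [show r * (1 - c / L) = r * (L - c) / L by field_simp]
  rw [div_le_iff₀ hLpos]
  rcases le_or_gt (198 * r) 1 with h | h
  · nlinarith
  · nlinarith [mul_nonneg (sub_nonneg.2 hr) (by linarith : (0 : ℚ) ≤ 198 * r + 6 / 5)]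

open scoped Classical in
/-- **The loss of a big thin pair in the cell `(3, 2)` is at most `1/40`.** -/
theorem loss_le_of_big_three_two (hG : G ∈ flatsQ M (5 + 1)) (hd : (gr M \ G).card = 3) (hk : kColoops M G = 2)
    (hs : ∀ e ∈ gr M, ∀ f ∈ gr M, e ≠ f → rkN M {e, f} = 2) (hl : ∀ e ∈ gr M, M.Indep {e}) {B : Finset α}
    (hB : B ∈ thinMembers M 5 G) (hbig : 4 ≤ (B \ coloops M G).card) {z : α} (hz : z ∈ G \ clF M B) :
    loss M 5 G B z ≤ 1 / 40 := by
  have hd' : (gr M \ G).card ≤ 5 := by omega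
  have hQ := insert_mem_shadowAt_thin hG hB hz
  have hQcard : 4 + 1 ≤ (insert z B \ coloops M G).card := by
    rw [card_insert_sdiff_coloops_thin hG hd' hB hz]; omega
  have hL1 := L1_le_req_add_of_three_two hG hd hk hs hl hQ hQcard (mem_thin_coverPreimages_insert hB hz)
  have hcap := capS_ge_five_twelfths_three_two hd hk (subset_G_of_mem_shadowAt hQ)
  have hreq := req_le_of_thin_three_two hG hd hB
  unfold loss fS
  split_ifs with h
  · norm_num
  · push Not at h
    exact loss_arith_three_two (req_nonneg 5 B) hreq hcap hL1 h

open scoped Classical in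
/-- **The loss of a big thin pair missing at least three points is at most `1/198`.** -/
theorem loss_le_of_big_three_two' (hG : G ∈ flatsQ M (5 + 1)) (hd : (gr M \ G).card = 3) (hk : kColoops M G = 2)
    (hs : ∀ e ∈ gr M, ∀ f ∈ gr M, e ≠ f → rkN M {e, f} = 2) (hl : ∀ e ∈ gr M, M.Indep {e}) {B : Finset α}
    (hB : B ∈ thinMembers M 5 G) (hbig : 4 ≤ (B \ coloops M G).card) (hm3 : 3 ≤ (G \ clF M B).card) {z : α}
    (hz : z ∈ G \ clF M B) : loss M 5 G B z ≤ 1 / 198 := by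
  have hd' : (gr M \ G).card ≤ 5 := by omega
  have hQ := insert_mem_shadowAt_thin hG hB hz
  have hQcard : 4 + 1 ≤ (insert z B \ coloops M G).card := by
    rw [card_insert_sdiff_coloops_thin hG hd' hB hz]; omega
  have hL1 := L1_le_req_add_of_three_two hG hd hk hs hl hQ hQcard (mem_thin_coverPreimages_insert hB hz)
  have hcap := capS_ge_five_twelfths_three_two hd hk (subset_G_of_mem_shadowAt hQ)
  have hreq := req_le_of_thin_three_two' hG hd hB hm3
  unfold loss fS
  split_ifs with h
  · norm_num
  · push Not at h
    exact loss_arith_three_two' (req_nonneg 5 B) hreq hcap hL1 h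

end ThreeTwoLoss

section MissedTarget

variable {G : Finset α}

open scoped Classical in
/-- In the cell `(3, 2)`, a thin covering preimage of the missed-point target `T = B ∪ {z, x}` of a thin pair is
`T ∖ w` for a point `w ∈ B` outside the coloops. -/
theorem thin_coverPreimage_missed_eq_erase (hG : G ∈ flatsQ M (5 + 1)) (hd : (gr M \ G).card ≤ 5)
    {B : Finset α} (hB : B ∈ thinMembers M 5 G) {z x : α} (hz : z ∈ G \ clF M B) (hx : x ∈ G \ clF M B)
    (hzx : z ≠ x) {B' : Finset α}
    (hB' : B' ∈ (coverPreimages M (Uq M (5 + 2) 5) G (insert x (insert z B))).filter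
      (fun B' => B' ∉ lay0 M 5 G)) :
    ∃ w ∈ B, w ∉ coloops M G ∧ B' = (insert x (insert z B)).erase w := by
  have hGg : G ⊆ gr M := (mem_flatsQ.1 hG).1
  have hBU : B ∈ Uq M (5 + 2) 5 := (mem_membersIn.1 (mem_thinMembers.1 hB).1).1
  have hBr : M.eRk (B : Set α) = ((5 : ℕ) : ℕ∞) := (mem_Uq.1 hBU).2.1
  have hzB : z ∉ B := notMem_of_notMem_clF hBU (Finset.mem_sdiff.1 hz).2
  have hxB : x ∉ B := notMem_of_notMem_clF hBU (Finset.mem_sdiff.1 hx).2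
  have hzE : z ∈ M.E := by rw [← coe_gr]; exact_mod_cast hGg (Finset.mem_sdiff.1 hz).1
  have hxE : x ∈ M.E := by rw [← coe_gr]; exact_mod_cast hGg (Finset.mem_sdiff.1 hx).1
  have hzcl : z ∉ M.closure (B : Set α) := by rw [← coe_clF]; exact_mod_cast (Finset.mem_sdiff.1 hz).2
  have hxcl : x ∉ M.closure (B : Set α) := by rw [← coe_clF]; exact_mod_cast (Finset.mem_sdiff.1 hx).2
  rw [Finset.mem_filter] at hB'
  obtain ⟨w, hwT, -, hB'eq⟩ := coverPreimage_eq_erase hB'.1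
  have hB'U : B' ∈ Uq M (5 + 2) 5 := (mem_membersIn.1 (mem_coverPreimages.1 hB'.1).1).1
  have hB'r : M.eRk (B' : Set α) = ((5 : ℕ) : ℕ∞) := (mem_Uq.1 hB'U).2.1
  have hB'thin : B' ∈ thinMembers M 5 G := mem_thinMembers.2 ⟨(mem_coverPreimages.1 hB'.1).1, hB'.2⟩
  have hK' : coloops M G ⊆ B' := coloops_subset_of_mem_thinMembers hG hd hB'thin
  have hsix : ∀ y, y ∈ M.E → y ∉ M.closure (B : Set α) → M.eRk ((insert y B : Finset α) : Set α) ≠ ((5 : ℕ) : ℕ∞) := by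
    intro y hyE hycl h
    rw [Finset.coe_insert, M.eRk_insert_eq_add_one ⟨hyE, hycl⟩, hBr] at h
    norm_num at h
  rw [Finset.mem_insert, Finset.mem_insert] at hwT
  rcases hwT with hwx | hwz | hwB
  · exfalso
    rw [hwx] at hB'eq
    have hB'z : B' = insert z B := by
      rw [hB'eq]
      exact Finset.erase_insert (by rw [Finset.mem_insert, not_or]; exact ⟨hzx.symm, hxB⟩)
    rw [hB'z] at hB'r
    exact hsix z hzE hzcl hB'r
  · exfalso
    rw [hwz] at hB'eq
    have hB'x : B' = insert x B := by
      rw [hB'eq, Finset.erase_insert_of_ne hzx.symm, Finset.erase_insert hzB]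
    rw [hB'x] at hB'r
    exact hsix x hxE hxcl hB'r
  · refine ⟨w, hwB, ?_, hB'eq⟩
    intro hwK
    have hwB' : w ∈ B' := hK' hwK
    rw [hB'eq] at hwB'
    exact (Finset.mem_erase.1 hwB').1 rfl

open scoped Classical in
/-- **A missed-point target of a big pair has at most one thin covering preimage** (cell `(3, 2)`): two faces
`T ∖ w`, `T ∖ w'` (`w ≠ w'` in `B ∖ K`) both contain `K ∪ (B ∖ {w, w'}) ∪ {z}`, a set of rank `5`, so they span the
same hyperplane and coincide. -/
theorem card_thin_coverPreimages_le_one_of_missed (hG : G ∈ flatsQ M (5 + 1)) (hd : (gr M \ G).card ≤ 5)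
    (hk : kColoops M G = 2) (hs : ∀ e ∈ gr M, ∀ f ∈ gr M, e ≠ f → rkN M {e, f} = 2)
    {B : Finset α} (hB : B ∈ thinMembers M 5 G) (hbig : 4 ≤ (B \ coloops M G).card)
    {z x : α} (hz : z ∈ G \ clF M B) (hx : x ∈ G \ clF M B) (hzx : z ≠ x) :
    ((coverPreimages M (Uq M (5 + 2) 5) G (insert x (insert z B))).filter
      (fun B' => B' ∉ lay0 M 5 G)).card ≤ 1 := by
  have hGg : G ⊆ gr M := (mem_flatsQ.1 hG).1
  have hBU : B ∈ Uq M (5 + 2) 5 := (mem_membersIn.1 (mem_thinMembers.1 hB).1).1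
  have hBg : B ⊆ gr M := (mem_Uq.1 hBU).1
  have hBG : B ⊆ G := (subset_clF hBU).trans (mem_membersIn.1 (mem_thinMembers.1 hB).1).2
  have hzB : z ∉ B := notMem_of_notMem_clF hBU (Finset.mem_sdiff.1 hz).2
  have hK : coloops M G ⊆ B := coloops_subset_of_mem_thinMembers hG hd hB
  have hzE : z ∈ M.E := by rw [← coe_gr]; exact_mod_cast hGg (Finset.mem_sdiff.1 hz).1
  have hzcl : z ∉ M.closure (B : Set α) := by rw [← coe_clF]; exact_mod_cast (Finset.mem_sdiff.1 hz).2
  set T := insert x (insert z B) with hT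
  rw [Finset.card_le_one]
  intro B₁ h₁ B₂ h₂
  obtain ⟨w₁, hw₁B, hw₁K, hB₁⟩ := thin_coverPreimage_missed_eq_erase hG hd hB hz hx hzx h₁
  obtain ⟨w₂, hw₂B, hw₂K, hB₂⟩ := thin_coverPreimage_missed_eq_erase hG hd hB hz hx hzx h₂
  by_cases hw : w₁ = w₂
  · rw [hB₁, hB₂, hw]
  -- the common set `X = {z} ∪ (B ∖ {w₁, w₂})` has rank `≥ 5`
  set Y := (B.erase w₁).erase w₂ with hY
  have hYB : Y ⊆ B := (Finset.erase_subset _ _).trans (Finset.erase_subset _ _)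
  set Y' := ((B \ coloops M G).erase w₁).erase w₂ with hY'
  have hYeq : Y = coloops M G ∪ Y' := by
    ext a
    simp only [hY, hY', Finset.mem_erase, Finset.mem_union, Finset.mem_sdiff]
    constructor
    · rintro ⟨haw₂, haw₁, haB⟩
      by_cases haK : a ∈ coloops M G
      · exact Or.inl haK
      · exact Or.inr ⟨haw₂, haw₁, haB, haK⟩
    · rintro (haK | ⟨haw₂, haw₁, haB, -⟩)
      · refine ⟨?_, ?_, hK haK⟩
        · rintro rfl; exact hw₂K haK
        · rintro rfl; exact hw₁K haK
      · exact ⟨haw₂, haw₁, haB⟩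
  have hdisj : Disjoint (coloops M G) Y' := by
    rw [Finset.disjoint_left]
    intro a haK haY'
    simp only [hY', Finset.mem_erase, Finset.mem_sdiff] at haY'
    exact haY'.2.2.2 haK
  have hY'G : Y' ⊆ G := fun a ha => by
    simp only [hY', Finset.mem_erase, Finset.mem_sdiff] at ha
    exact hBG ha.2.2.1
  have hcol : ∀ y ∈ coloops M G, y ∈ G ∧ y ∉ clF M (G.erase y) := fun y hy => mem_coloops.1 hy
  have hY'2 : 2 ≤ Y'.card := by
    rw [hY']
    have h1 := Finset.pred_card_le_card_erase (s := (B \ coloops M G).erase w₁) (a := w₂)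
    have h2 := Finset.pred_card_le_card_erase (s := B \ coloops M G) (a := w₁)
    omega
  have hY'r : ((2 : ℕ) : ℕ∞) ≤ M.eRk (Y' : Set α) := by
    rw [eRk_eq_rkN]
    exact_mod_cast two_le_rkN_of_two_le_card hs (hY'G.trans hGg) hY'2
  have hY4 : ((4 : ℕ) : ℕ∞) ≤ M.eRk (Y : Set α) := by
    rw [hYeq, Finset.coe_union, ← Finset.coe_union, eRk_union_coloops hGg (coloops M G) hcol hY'G hdisj,
      ← kColoops_eq_card_coloops, hk]
    calc ((4 : ℕ) : ℕ∞) = ((2 : ℕ) : ℕ∞) + ((2 : ℕ) : ℕ∞) := by norm_num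
      _ ≤ ((2 : ℕ) : ℕ∞) + M.eRk (Y' : Set α) := by gcongr
  have hzY : z ∉ M.closure (Y : Set α) := fun h =>
    hzcl (M.closure_subset_closure (by exact_mod_cast hYB) h)
  set X := insert z Y with hX
  have hXr : ((5 : ℕ) : ℕ∞) ≤ M.eRk (X : Set α) := by
    rw [hX, Finset.coe_insert, M.eRk_insert_eq_add_one ⟨hzE, hzY⟩]
    calc ((5 : ℕ) : ℕ∞) = ((4 : ℕ) : ℕ∞) + 1 := by norm_num
      _ ≤ M.eRk (Y : Set α) + 1 := by gcongr
  have hXsub : ∀ w, (w = w₁ ∨ w = w₂) → X ⊆ T.erase w := by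
    intro w hw a ha
    rw [Finset.mem_erase]
    rw [hX, Finset.mem_insert] at ha
    rcases ha with rfl | haY
    · refine ⟨?_, by rw [hT]; exact Finset.mem_insert_of_mem (Finset.mem_insert_self _ _)⟩
      intro haw
      rcases hw with hw | hw
      · exact hzB (haw ▸ hw ▸ hw₁B)
      · exact hzB (haw ▸ hw ▸ hw₂B)
    · refine ⟨?_, by rw [hT]; exact Finset.mem_insert_of_mem (Finset.mem_insert_of_mem (hYB haY))⟩
      simp only [hY, Finset.mem_erase] at haY
      rcases hw with rfl | rfl
      · exact haY.2.1
      · exact haY.1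
  have hcl : ∀ B' ∈ (coverPreimages M (Uq M (5 + 2) 5) G T).filter (fun B' => B' ∉ lay0 M 5 G),
      ∀ w, (w = w₁ ∨ w = w₂) → B' = T.erase w → clF M X = clF M B' := by
    intro B' hB' w hw hB'eq
    have hB'U : B' ∈ Uq M (5 + 2) 5 :=
      (mem_membersIn.1 (mem_coverPreimages.1 (Finset.mem_filter.1 hB').1).1).1
    have hB'r : M.eRk (B' : Set α) = ((5 : ℕ) : ℕ∞) := (mem_Uq.1 hB'U).2.1
    have hXB' : X ⊆ B' := by rw [hB'eq]; exact hXsub w hw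
    have hfl : clF M B' ∈ flatsQ M (4 + 1) := by
      rw [mem_flatsQ]
      refine ⟨?_, ?_, ?_⟩
      · rw [← Finset.coe_subset, coe_clF, coe_gr]; exact M.closure_subset_ground _
      · rw [coe_clF]; exact M.isFlat_closure _
      · rw [coe_clF, M.eRk_closure_eq, hB'r]
    have hXcl : clF M X ⊆ clF M B' := by
      rw [← Finset.coe_subset, coe_clF, coe_clF]
      exact M.closure_subset_closure (by exact_mod_cast hXB')
    apply flat_eq_of_subset_of_eRk_eq hfl (by rw [coe_clF]; exact M.isFlat_closure _) hXcl
    rw [coe_clF, M.eRk_closure_eq]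
    apply le_antisymm
    · calc M.eRk (X : Set α) ≤ M.eRk (B' : Set α) := M.eRk_mono (by exact_mod_cast hXB')
        _ = _ := hB'r
    · exact hXr
  have e₁ := hcl B₁ h₁ w₁ (Or.inl rfl) hB₁
  have e₂ := hcl B₂ h₂ w₂ (Or.inr rfl) hB₂
  exact clF_injOn_coverPreimages (Finset.mem_filter.1 h₁).1 (Finset.mem_filter.1 h₂).1 (e₁.symm.trans e₂)

open scoped Classical in
/-- **A missed-point target of a big pair keeps `cap2 ≥ 11/60`** (cell `(3, 2)`): at most one thin covering preimage,
requesting `≤ 7/30`, against a capacity `≥ 5/12`. -/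
theorem cap2_ge_of_missed_three_two (hG : G ∈ flatsQ M (5 + 1)) (hd : (gr M \ G).card = 3)
    (hk : kColoops M G = 2) (hs : ∀ e ∈ gr M, ∀ f ∈ gr M, e ≠ f → rkN M {e, f} = 2)
    {B : Finset α} (hB : B ∈ thinMembers M 5 G) (hbig : 4 ≤ (B \ coloops M G).card)
    {z x : α} (hz : z ∈ G \ clF M B) (hx : x ∈ G \ clF M B) (hzx : z ≠ x) :
    (11 / 60 : ℚ) ≤ cap2 M 5 G (insert x (insert z B)) := by
  have hd' : (gr M \ G).card ≤ 5 := by omega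
  set T := insert x (insert z B) with hT
  have hTG : T ⊆ G := by
    have hBG : B ⊆ G := (subset_clF (mem_membersIn.1 (mem_thinMembers.1 hB).1).1).trans
      (mem_membersIn.1 (mem_thinMembers.1 hB).1).2
    rw [hT]
    exact Finset.insert_subset (Finset.mem_sdiff.1 hx).1 (Finset.insert_subset (Finset.mem_sdiff.1 hz).1 hBG)
  set P := (coverPreimages M (Uq M (5 + 2) 5) G T).filter (fun B' => B' ∉ lay0 M 5 G) with hP
  have hP1 : P.card ≤ 1 := card_thin_coverPreimages_le_one_of_missed hG hd' hk hs hB hbig hz hx hzx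
  have hL1 : L1 M 5 G T = ∑ B' ∈ P, req M 5 B' := rfl
  have hthin : ∀ B' ∈ P, B' ∈ thinMembers M 5 G := by
    intro B' hB'
    rw [hP, Finset.mem_filter, mem_coverPreimages] at hB'
    exact mem_thinMembers.2 ⟨hB'.1.1, hB'.2⟩
  have hL1le : L1 M 5 G T ≤ 7 / 30 := by
    rw [hL1]
    calc ∑ B' ∈ P, req M 5 B' ≤ ∑ _B' ∈ P, (7 / 30 : ℚ) :=
          Finset.sum_le_sum (fun B' hB' => req_le_of_thin_three_two hG hd (hthin B' hB'))
      _ = (P.card : ℚ) * (7 / 30) := by rw [Finset.sum_const, nsmul_eq_mul]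
      _ ≤ 1 * (7 / 30) := by
          have : (P.card : ℚ) ≤ 1 := by exact_mod_cast hP1
          nlinarith
      _ = 7 / 30 := by norm_num
  have hcap := capS_ge_five_twelfths_three_two hd hk hTG
  unfold cap2 fS
  rw [if_pos (by linarith)]
  linarith

end MissedTarget

end PercRepro.Shadow
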